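import Summits.RiemannHypothesis.RiemannHypothesis.Theorems.S2FormatCShapes
import Summits.RiemannHypothesis.RiemannHypothesis.Theorems.S2FormatCE0Sound
import Summits.RiemannHypothesis.RiemannHypothesis.Theorems.WeilFormatCEntry
import Summits.RiemannHypothesis.RiemannHypothesis.Theorems.WeilFormatCSectorSplit
import Summits.RiemannHypothesis.RiemannHypothesis.Theorems.WeilFormatCEntryArchIntegrals
import Summits.RiemannHypothesis.RiemannHypothesis.Theorems.WeilFormatCWindowDictionaryTwo
import HarnessLib

/-!
# Format C at `S = {∞, 2}` — BRIDGES: `EntryTheoremTwo` and `SectorSplitTwo` are theorems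

Seat cc-s2-4 gen3 (`HOME/cc-s2-4/CC4-LEAN.md` §9.4).  From weil-2's tree files `WeilFormatCEntry`
(`semilocalTwoWindowForm_sum_smul_chi`) and `WeilFormatCSectorSplit` (`sum_modes_re_conj_mul_nonneg_of_sectors`):
`entryTheoremTwo_of_pos (0 < b) (log 2 ≤ 2b)`, `sectorSplitTwo_holds b`, via the reflection symmetry `gram_refl` and the
partial-fraction identity `expsumOff_eq`; `le_threshold_of_formatC₂` = the composition with these two discharged.
-/

set_option linter.dupNamespace false
set_option autoImplicit false

noncomputable section

open Complex Set MeasureTheory Filter Finset Matrix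
open scoped Real Topology ComplexConjugate BigOperators

namespace Summit.RiemannHypothesis.RiemannHypothesis.Theorems.S2FormatC

open Literature.NumberTheory.LFunctions Literature.Analysis.SpecialFunctions
open Summit.RiemannHypothesis.RiemannHypothesis.Theorems.MotivicDoor.SemilocalMarkov
open Summit.RiemannHypothesis.RiemannHypothesis.Theorems.MotivicDoor.SemilocalThreshold

section Bridge

variable {b : ℝ}

/-! ### Parity bookkeeping -/

/-- `sgn k = (−1)^k`. -/
theorem sgn_eq_zpow (k : ℤ) : sgn k = (-1 : ℝ) ^ k := by
  unfold sgn
  split_ifs with h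
  · exact (Even.neg_one_zpow h).symm
  · exact (Odd.neg_one_zpow (Int.not_even_iff_odd.1 h)).symm

/-- `sgn (n − m) = sgn (n + m)`. -/
theorem sgn_sub_eq (n m : ℤ) : sgn (n - m) = sgn (n + m) := by
  unfold sgn
  simp only [Int.even_sub, Int.even_add]

/-- `sgn (−k) = sgn k`. -/
theorem sgn_neg (k : ℤ) : sgn (-k) = sgn k := by
  unfold sgn; simp only [even_neg]

/-- `ω_{−n} = −ω_n`. -/
theorem omega_neg (b : ℝ) (n : ℤ) : omega b (-n) = -omega b n := by
  unfold omega; push_cast; ring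

/-- `S0` is even in the mode. -/
theorem S0_neg (b : ℝ) (n : ℤ) : S0 b (-n) = S0 b n := by
  unfold S0; simp only [omega_neg, neg_sq]

/-- `S2` is even in the mode. -/
theorem S2_neg (b : ℝ) (n : ℤ) : S2 b (-n) = S2 b n := by
  unfold S2; simp only [omega_neg, neg_sq]

/-- `Sdiag` is even in the mode. -/
theorem Sdiag_neg (b : ℝ) (n : ℤ) : Sdiag b (-n) = Sdiag b n := by
  unfold Sdiag; simp only [omega_neg, neg_sq]

/-- The evaluation point for `−n` is the conjugate point. -/
theorem quarter_neg_eq_conj (b : ℝ) (n : ℤ) :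
    (1 / 4 + (omega b (-n) : ℂ) / 2 * I) = conj (1 / 4 + (omega b n : ℂ) / 2 * I) := by
  have h1 : (1 / 4 + (omega b n : ℂ) / 2 * I) = ⟨1 / 4, omega b n / 2⟩ := by
    apply Complex.ext <;> simp
  have h2 : (1 / 4 + (omega b (-n) : ℂ) / 2 * I) = ⟨1 / 4, -(omega b n / 2)⟩ := by
    rw [omega_neg]; apply Complex.ext <;> simp [neg_div]
  rw [h1, h2]
  apply Complex.ext <;> simp

/-- `Im ψ` is odd in the mode. -/
theorem imPsi_neg (b : ℝ) (n : ℤ) : imPsi b (-n) = -imPsi b n := by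
  unfold imPsi
  rw [quarter_neg_eq_conj, digamma_conj, Complex.conj_im]

/-- `Re ψ` is even in the mode. -/
theorem rePsi_neg (b : ℝ) (n : ℤ) : rePsi b (-n) = rePsi b n := by
  unfold rePsi reDigammaQuarter
  have e : (1 / 4 + ((omega b (-n) : ℝ) : ℂ) / 2 * I) = conj (1 / 4 + ((omega b n : ℝ) : ℂ) / 2 * I) :=
    quarter_neg_eq_conj b n
  rw [e, digamma_conj, Complex.conj_re]

/-- `Re ψ′` is even in the mode (from the real series `Σ 4(l_k² − ω²)/(l_k² + ω²)²`). -/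
theorem rePsi'_neg (b : ℝ) (n : ℤ) : rePsi' b (-n) = rePsi' b n := by
  unfold rePsi'
  have h1 := WeilFormatC.hasSum_re_deriv_digamma_quarter (omega b (-n))
  have h2 := WeilFormatC.hasSum_re_deriv_digamma_quarter (omega b n)
  rw [omega_neg] at h1
  simp only [neg_sq] at h1
  rw [omega_neg]
  exact h1.unique h2

/-- `expsumOff` is reflection-invariant. -/
theorem expsumOff_neg (b : ℝ) (n m : ℤ) : expsumOff b (-n) (-m) = expsumOff b n m := by
  unfold expsumOff
  simp only [neg_inj, S0_neg, S2_neg, omega_neg, neg_mul_neg, neg_sq]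

/-- **Reflection symmetry** `G₂(−n, −m) = G₂(n, m)`. -/
theorem gram_refl (b : ℝ) (n m : ℤ) : gram b (-n) (-m) = gram b n m := by
  have e1 : -n + -m = -(n + m) := by ring
  have e2 : -n - -m = -(n - m) := by ring
  have hpol : polarG b (-n) (-m) = polarG b n m := by
    unfold polarG; rw [e1, sgn_neg, omega_neg, omega_neg]; ring
  have hd : π * (((-n : ℤ) : ℝ) - ((-m : ℤ) : ℝ)) = -(π * ((n : ℝ) - m)) := by push_cast; ring
  have hpri : primeG b (-n) (-m) = primeG b n m := by
    unfold primeG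
    by_cases h : n = m
    · subst h; simp only [if_true, omega_neg, neg_mul, Real.cos_neg]
    · have h' : ¬(-n = -m) := fun e ↦ h (neg_inj.1 e)
      simp only [h, h', if_false]
      rw [hd, e2, sgn_neg, omega_neg, omega_neg, div_neg]
      simp only [neg_mul, Real.sin_neg]
      ring
  have harch : archG b (-n) (-m) = archG b n m := by
    unfold archG
    by_cases h : n = m
    · subst h; simp only [if_true, Sdiag_neg, rePsi_neg, rePsi'_neg]
    · have h' : ¬(-n = -m) := fun e ↦ h (neg_inj.1 e)
      simp only [h, h', if_false]
      rw [hd, e1, sgn_neg, expsumOff_neg, imPsi_neg, imPsi_neg, div_neg]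
      ring
  unfold gram
  rw [hpol, hpri, harch]
  simp only [neg_inj]

/-! ### Summability and the partial-fraction identity behind `expsumOff` -/

/-- `e_k = e_0 r^k`, `r = e^{−4b}` (the `K = 0` case of `E0.eNode_add`). -/
theorem eNode_eq_geom (b : ℝ) (k : ℕ) : eNode b k = eNode b 0 * Real.exp (-(4 * b)) ^ k := by
  simpa using E0.eNode_add b k 0

/-- `Σ e_k` converges (`b > 0`). -/
theorem summable_eNode (hb : 0 < b) : Summable (eNode b) := by
  have hr0 : 0 ≤ Real.exp (-(4 * b)) := (Real.exp_pos _).le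
  have hr1 : Real.exp (-(4 * b)) < 1 := Real.exp_lt_one_iff.2 (by linarith)
  have h := (summable_geometric_of_lt_one hr0 hr1).mul_left (eNode b 0)
  exact h.congr fun k ↦ (eNode_eq_geom b k).symm

/-- `Σ e_k/(l_k² + ω²)` converges. -/
theorem summable_S0_term (hb : 0 < b) (n : ℤ) :
    Summable fun k ↦ eNode b k / (digammaNode k ^ 2 + omega b n ^ 2) := by
  refine Summable.of_nonneg_of_le (fun k ↦ ?_) (fun k ↦ ?_) ((summable_eNode hb).mul_left 4)
  · have := E0.eNode_pos b k; have := digammaNode_pos k; positivity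
  · have he := E0.eNode_pos b k
    have hl := one_half_le_digammaNode k
    have hden : 1 / 4 ≤ digammaNode k ^ 2 + omega b n ^ 2 := by nlinarith [sq_nonneg (omega b n)]
    rw [div_le_iff₀ (by positivity)]
    nlinarith

/-- `S2_n = E − ω_n² S0_n`. -/
theorem S2_eq (hb : 0 < b) (n : ℤ) : S2 b n = eTot b - omega b n ^ 2 * S0 b n := by
  unfold S2 eTot S0
  rw [← tsum_mul_left, ← (summable_eNode hb).tsum_sub ((summable_S0_term hb n).mul_left _)]
  refine tsum_congr fun k ↦ ?_
  have hden : 0 < digammaNode k ^ 2 + omega b n ^ 2 := by have := digammaNode_pos k; positivity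
  rw [eq_sub_iff_add_eq, ← mul_div_assoc, ← add_div, div_eq_iff hden.ne']
  ring

/-- **The partial-fraction identity**: for `n ≠ m`,
`expsumOff(n,m) = (ω_n S0_n − ω_m S0_m)/(ω_n − ω_m)` (weil-2's `(T_n − T_m)/(ω_n − ω_m)` form). -/
theorem expsumOff_eq (hb : 0 < b) {n m : ℤ} (hnm : n ≠ m) :
    expsumOff b n m = (omega b n * S0 b n - omega b m * S0 b m) / (omega b n - omega b m) := by
  have hπ : 0 < π := Real.pi_pos
  have hωsub : omega b n - omega b m ≠ 0 := by
    unfold omega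
    rw [← sub_div, ← mul_sub]
    have : (n : ℝ) - m ≠ 0 := by
      have : (n : ℝ) ≠ m := by exact_mod_cast hnm
      exact sub_ne_zero.2 this
    positivity
  unfold expsumOff
  by_cases h : m = -n
  · subst h
    simp only [if_true, omega_neg, S0_neg]
    have hden : omega b n - -omega b n ≠ 0 := by rw [omega_neg] at hωsub; exact hωsub
    rw [eq_div_iff hden]
    ring
  · simp only [h, if_false]
    rw [S2_eq hb n, S2_eq hb m]
    have hadd : omega b m + omega b n ≠ 0 := by
      unfold omega
      rw [← add_div, ← mul_add]
      have : (m : ℝ) + n ≠ 0 := by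
        have : (m : ℝ) ≠ -n := by exact_mod_cast h
        intro e; apply this; linarith
      positivity
    have hsq : omega b m ^ 2 - omega b n ^ 2 ≠ 0 := by
      rw [sq_sub_sq]; exact mul_ne_zero hadd (by intro e; apply hωsub; linarith)
    field_simp
    ring

/-! ### The entry theorem -/

/-- `Σ' e_k·(ω/(l_k²+ω²)) = ω·S0` (weil-2's `T_j`). -/
theorem tsum_T_eq (b : ℝ) (n : ℤ) :
    ∑' k : ℕ, Real.exp (-(2 * b * digammaNode k)) * ((π * n / b) / (digammaNode k ^ 2 + (π * n / b) ^ 2)) =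
      omega b n * S0 b n := by
  unfold S0 omega eNode
  rw [← tsum_mul_left]
  exact tsum_congr fun k ↦ by ring

/-- weil-2's diagonal exponential sum is `Sdiag`. -/
theorem tsum_diag_eq (b : ℝ) (n : ℤ) :
    ∑' k : ℕ, Real.exp (-(2 * b * digammaNode k)) *
        ((digammaNode k ^ 2 - (π * n / b) ^ 2) / (digammaNode k ^ 2 + (π * n / b) ^ 2) ^ 2) = Sdiag b n := by
  unfold Sdiag omega eNode
  exact tsum_congr fun k ↦ by ring

/-- **ENTRY THEOREM at `S = {2}` PROVED**: `EntryTheoremTwo b` for `0 < b`, `log 2 ≤ 2b` — the closed-form matrix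
`gram b` IS the matrix of the `{∞,2}` window form on Yoshida's basis (weil-2's `semilocalTwoWindowForm_sum_smul_chi`
plus the partial-fraction identity `expsumOff_eq`). -/
theorem entryTheoremTwo_of_pos (hb : 0 < b) (hb2 : Real.log 2 ≤ 2 * b) : EntryTheoremTwo b := by
  intro N c
  unfold windowFormTwo trigWindow lam
  rw [WeilFormatC.semilocalTwoWindowForm_sum_smul_chi hb hb2]
  refine Finset.sum_congr rfl fun n _ ↦ Finset.sum_congr rfl fun m _ ↦ ?_
  congr 1
  have hπ : π ≠ 0 := Real.pi_pos.ne'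
  have hb0 : b ≠ 0 := hb.ne'
  rw [tsum_T_eq, tsum_T_eq, tsum_diag_eq]
  -- polar block
  have hpol : polarG b n m = (-1 : ℝ) ^ (n + m) * (4 / b) * (Real.exp (b / 2) - Real.exp (-(b / 2))) ^ 2 *
      (1 - 4 * (π * n / b) * (π * m / b)) / ((1 + 4 * (π * n / b) ^ 2) * (1 + 4 * (π * m / b) ^ 2)) := by
    unfold polarG sSq omega; rw [sgn_eq_zpow]; ring
  -- prime block
  have hpri : primeG b n m = Real.log 2 / Real.sqrt 2 *
      ((if n = m then 2 - 2 * (1 - Real.log 2 / (2 * b)) * Real.cos (π * n / b * Real.log 2)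
        else -(-1 : ℝ) ^ (n + m) * (Real.sin (π * m / b * Real.log 2) - Real.sin (π * n / b * Real.log 2)) /
          (π * (n - m))) - (if n = m then 2 else 0)) := by
    unfold primeG lam omega
    by_cases h : n = m
    · simp only [h, if_true]; ring
    · simp only [h, if_false]; rw [sgn_sub_eq, sgn_eq_zpow]; ring
  -- archimedean block
  have harch : archG b n m - (if n = m then Real.log π else 0) =
      (if n = m then
        reDigammaQuarter (π * n / b) - Real.log π +
          (deriv Complex.digamma (1 / 4 + ((π * n / b : ℝ) : ℂ) / 2 * I)).re / (4 * b) - Sdiag b n / b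
      else -(-1 : ℝ) ^ (n + m) / (π * (n - m)) *
        (((Complex.digamma (1 / 4 + ((π * m / b : ℝ) : ℂ) / 2 * I)).im / 2 - omega b m * S0 b m) -
          ((Complex.digamma (1 / 4 + ((π * n / b : ℝ) : ℂ) / 2 * I)).im / 2 - omega b n * S0 b n))) := by
    unfold archG
    by_cases h : n = m
    · subst h
      simp only [if_true]
      unfold rePsi rePsi' omega
      field_simp
      ring
    · simp only [h, if_false, sub_zero]
      rw [expsumOff_eq hb h, sgn_eq_zpow]
      unfold imPsi omega
      have hnm : (n : ℝ) - m ≠ 0 := sub_ne_zero.2 (by exact_mod_cast h)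
      have hω : π * n / b - π * m / b = π * (n - m) / b := by ring
      rw [hω]
      field_simp
      ring
  unfold gram
  linear_combination (-1 : ℝ) * (hpol + hpri + harch)

/-! ### The sector split -/

/-- **SECTOR SPLIT at `S = {2}` PROVED**: `SectorSplitTwo b` (weil-2's generic `sum_modes_re_conj_mul_nonneg_of_sectors`
with `G = gram b`, `gramEven = D·(2M⁺)·D`-type rescaling with `D = diag(√2, 1, 1, …)`, `gramOdd = 2M⁻` shifted). -/
theorem sectorSplitTwo_holds (b : ℝ) : SectorSplitTwo b := by
  intro heven hodd N c
  refine WeilFormatC.sum_modes_re_conj_mul_nonneg_of_sectors (gram b) (fun n m ↦ gram_refl b n m) N ?_ ?_ c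
  · -- even sector: x = (√2 y₀, y₁, y₂, …) turns `gramEven` into `2·M⁺`
    intro y
    have h := heven N (fun n ↦ if n = 0 then Real.sqrt 2 * y 0 else y n)
    have hs : Real.sqrt 2 * Real.sqrt 2 = 2 := Real.mul_self_sqrt (by norm_num)
    have key : ∑ n ∈ range (N + 1), ∑ m ∈ range (N + 1),
        (if n = 0 then Real.sqrt 2 * y 0 else y n) * (if m = 0 then Real.sqrt 2 * y 0 else y m) * gramEven b n m =
        2 * ∑ n ∈ range (N + 1), ∑ m ∈ range (N + 1),
          y n * y m * (if n = 0 then gram b 0 m else if m = 0 then gram b n 0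
            else (gram b n m + gram b n (-(m : ℤ))) / 2) := by
      rw [Finset.mul_sum]
      refine Finset.sum_congr rfl fun n _ ↦ ?_
      rw [Finset.mul_sum]
      refine Finset.sum_congr rfl fun m _ ↦ ?_
      unfold gramEven
      by_cases hn : n = 0 <;> by_cases hm : m = 0
      · subst hn; subst hm; simp only [if_true, and_self]; push_cast
        linear_combination (y 0 * y 0 * gram b 0 0) * hs
      · subst hn; simp only [if_true, hm, if_false, and_false]
        linear_combination (y 0 * y m * gram b 0 m) * hs
      · subst hm; simp only [if_true, hn, if_false, false_and]
        linear_combination (y n * y 0 * gram b n 0) * hs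
      · simp only [hn, hm, if_false, and_self]; ring
    rw [key] at h
    linarith
  · -- odd sector: reindex `Icc 1 N` ↔ `range N`, `gramOdd(k+1,l+1) = 2·M⁻(k,l)`
    intro z
    have h := hodd N (fun n ↦ z (n - 1))
    have key : ∑ n ∈ Icc 1 N, ∑ m ∈ Icc 1 N, z (n - 1) * z (m - 1) * gramOdd b n m =
        2 * ∑ k ∈ range N, ∑ l ∈ range N,
          z k * z l * ((gram b ((k : ℤ) + 1) ((l : ℤ) + 1) - gram b ((k : ℤ) + 1) (-((l : ℤ) + 1))) / 2) := by
      rw [Finset.mul_sum]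
      have e1 : Finset.Icc 1 N = Finset.image (fun k ↦ k + 1) (Finset.range N) := by
        ext n
        simp only [Finset.mem_Icc, Finset.mem_image, Finset.mem_range]
        constructor
        · rintro ⟨h1, h2⟩; exact ⟨n - 1, by omega, by omega⟩
        · rintro ⟨k, hk, rfl⟩; omega
      rw [e1, Finset.sum_image (fun a _ b _ hab ↦ by omega)]
      refine Finset.sum_congr rfl fun k _ ↦ ?_
      rw [Finset.mul_sum, Finset.sum_image (fun a _ b _ hab ↦ by omega)]
      refine Finset.sum_congr rfl fun l _ ↦ ?_
      unfold gramOdd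
      simp only [Nat.add_sub_cancel]
      push_cast
      ring
    rw [key] at h
    linarith

/-- **§5's composition with the entry theorem and the sector split DISCHARGED** (this file's §9): on GO, a verified
S = {2} format-C certificate closes `WeilSemilocalPositivityOn {2} b ∧ b ≤ a*({2})` modulo ONLY the dictionary and the
per-sector far/tail/reduction statements. -/
theorem le_threshold_of_formatC₂ {b : ℝ} (hb : 0 < b) (hb2 : Real.log 2 ≤ 2 * b) (De Do : SectorData)
    (hDe : De.odd = false) (hDo : Do.odd = true) (hDict : DictionaryTwo b)
    (hFe : FarCoercivityTwo false b De.M₁) (hTe : ColumnTailTwo De b) (hγe : 0 < De.γ)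
    (hγe' : De.γ ≤ gammaFar false b De.M₁) (hRe : SectorReductionTwo De b)
    (hFo : FarCoercivityTwo true b Do.M₁) (hTo : ColumnTailTwo Do b) (hγo : 0 < Do.γ)
    (hγo' : Do.γ ≤ gammaFar true b Do.M₁) (hRo : SectorReductionTwo Do b)
    {δe ρe δo ρo : ℤ} {mide Le mido Lo : List (List ℤ)} {ue uo : ℝ}
    (hPe : PsdDyadic.checkPsdMid De.dim δe ρe mide Le = true) (hue : 0 < ue)
    (hEe : EntrywiseEnclosed (schurS De b) mide ρe ue)
    (hPo : PsdDyadic.checkPsdMid Do.dim δo ρo mido Lo = true) (huo : 0 < uo)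
    (hEo : EntrywiseEnclosed (schurS Do b) mido ρo uo) :
    WeilSemilocalPositivityOn {2} b ∧ b ≤ weilSemilocalThreshold {2} :=
  le_threshold_of_formatC De Do hDe hDo (entryTheoremTwo_of_pos hb hb2) (sectorSplitTwo_holds b) hDict hFe hTe hγe
    hγe' hRe hFo hTo hγo hγo' hRo hPe hue hEe hPo huo hEo

end Bridge


/-! ## Appendix (append-only, 2026-08-22, cc-s2-4 gen3): the DICTIONARY is a theorem too (weil-3's
`WeilFormatCWindowDictionaryTwo`), so the S = {2} composition needs only L-C3 + the certificates -/

section BridgeDict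

variable {b : ℝ}

/-- **DICTIONARY at `S = {2}` PROVED**: `DictionaryTwo b` for `0 < b ≤ log 2`, from weil-3's tree theorem
`WeilFormatC.weilSemilocalPositivityOn_two_of_window_sum_chi_nonneg` (whose hypothesis is `windowFormTwo (trigWindow b N c)`
unfolded). -/
theorem dictionaryTwo_holds (hb : 0 < b) (hb2 : b ≤ Real.log 2) : DictionaryTwo b := by
  intro h
  exact WeilFormatC.weilSemilocalPositivityOn_two_of_window_sum_chi_nonneg hb hb2 fun N c ↦ by
    have h' := h N c
    unfold windowFormTwo trigWindow lam at h'
    exact h'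

/-- **THE S = {2} COMPOSITION WITH ENTRY, SPLIT AND DICTIONARY DISCHARGED** (`(log 2)/2 ≤ b ≤ log 2`): a verified
format-C certificate — per sector a checked `PsdDyadic` certificate (P) of the entrywise-enclosed (E) Schur matrix — closes
`WeilSemilocalPositivityOn {2} b ∧ b ≤ a*({2})` modulo ONLY the per-sector L-C3 statements (`FarCoercivityTwo`,
`ColumnTailTwo`, `SectorReductionTwo` with `0 < γ ≤ gammaFar`). -/
theorem le_threshold_of_formatC₃ (hb : 0 < b) (hb1 : Real.log 2 ≤ 2 * b) (hb2 : b ≤ Real.log 2)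
    (De Do : SectorData) (hDe : De.odd = false) (hDo : Do.odd = true)
    (hFe : FarCoercivityTwo false b De.M₁) (hTe : ColumnTailTwo De b) (hγe : 0 < De.γ)
    (hγe' : De.γ ≤ gammaFar false b De.M₁) (hRe : SectorReductionTwo De b)
    (hFo : FarCoercivityTwo true b Do.M₁) (hTo : ColumnTailTwo Do b) (hγo : 0 < Do.γ)
    (hγo' : Do.γ ≤ gammaFar true b Do.M₁) (hRo : SectorReductionTwo Do b)
    {δe ρe δo ρo : ℤ} {mide Le mido Lo : List (List ℤ)} {ue uo : ℝ}
    (hPe : PsdDyadic.checkPsdMid De.dim δe ρe mide Le = true) (hue : 0 < ue)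
    (hEe : EntrywiseEnclosed (schurS De b) mide ρe ue)
    (hPo : PsdDyadic.checkPsdMid Do.dim δo ρo mido Lo = true) (huo : 0 < uo)
    (hEo : EntrywiseEnclosed (schurS Do b) mido ρo uo) :
    WeilSemilocalPositivityOn {2} b ∧ b ≤ weilSemilocalThreshold {2} :=
  le_threshold_of_formatC₂ hb hb1 De Do hDe hDo (dictionaryTwo_holds hb hb2) hFe hTe hγe hγe' hRe hFo hTo hγo
    hγo' hRo hPe hue hEe hPo huo hEo

end BridgeDict

end Summit.RiemannHypothesis.RiemannHypothesis.Theorems.S2FormatC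

end
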